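/-
Copyright: the b2b-balaban T⁴-continuum CRUX team, row NE7b OWNER lineage `t4-ne7b-p1` (gen 135). Project licence.
-/
import Summits.QuantumFields.BalabanUV.T4Continuum.Spine.NE7b.SupFineCellRegulator

/-!
# THE ACTIVITY LETTER WITH FINE-CELL LARGE-FIELD BOOKKEEPING — (289) REBUILT WITH LOCAL MARGINS: big cells `cell p` (disjoint, `≤ v` sites)
# carrying finitely many FINE cells `fine p` (subsets of `cell p`, `≤ v₀` sites, `≤ m` per big cell) and factors obeying the fine-cell two-letter
# pointwise bound (what (376) becomes when the small-field region is «every fine cell small»)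
#   `‖g_p(ω)‖ ≤ ε + 1{∃c ∈ fine p : r² < Σ_{x∈c}ω_x²}·M·e^{½κ₁Σ_{x∈cell p}ω_x²}`
# integrate, for EVERY finite `K`, to
#   `‖∫∏_{p∈K}g_p dN(0,Γ)‖ ≤ (ε + m·M·e^{−½κ₂r²}·A₁^v·A₂^{v₀})^{#K}`,  `A₁ = (1−θ)^{−2κ₁γ∕(2θ)}`, `A₂ = (1−θ)^{−2κ₂γ∕(2θ)}`,
# under the SMALL stability rate's GLOBAL margin `2κ₁γ_op ≤ θ` and the LARGE conversion rate's LOCAL margin `2κ₂γ₂ ≤ θ` where `γ₂` bounds `Γ`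
# restricted to the SPARSE unions of fine cells (one fine cell per big cell of any `S ⊆ K`) — expand `∏(ε + F_p)` over subsets, the indicators by
# (378)'s union bound, the products of sums over choice functions, pay each choice with (378)'s two-rate cost, re-sum: the multi-scale-consistent
# replacement of (289)'s `norm_cellActivity_le_of_regulated` (whose single global margin `κγ_op ≤ θ` is what (374) showed cannot be met along the
# scales); SCOPING-d7 (α2)+(α3) (row NE7b, node U5c; (378) BY NAME + `Finset.prod_add` ∕ `Finset.prod_sum`; [folklore])

Cell `pub-balaban`, sub-cell `t4`, spine estimate NE7b (`T4WeightBudget.RelWeightBound`; the cell's OWN estimate — NOT PRINTED in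
[Bałaban 1983–89], NOT PROVED).  Crux-route work under `Spine/NE7b/` by the row OWNER (`t4-ne7b-p1` gen 135, file (379)) under FREEZE
(0)'s crux-prover clause, on this gen's SCOPING-d7 DECISION (1) (honest form); NOTHING of Bałaban's is named as a Lean object, valued or asserted;
no `T4Continuum/Support` leaf typed; no `def`, no notation; zero `sorry`.  Imports (BY NAME): the OWNER's (378) `…SupFineCellRegulator`
(`indicator_exists_le_sum`, `integral_twoRate_le`, `integrable_exp_half_sq_on_local`, `exp_add_le_half_add`; through it (288)
`integrable_exp_half_sq_on`, (289) `one_le_regulatorCost`, `card_biUnion_cell_le`); Mathlib's `Finset.prod_add`, `Finset.prod_sum`, `Finset.card_pi`,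
`Finset.prod_le_pow_card`, `Finset.sum_pow_mul_eq_add_pow`, `Finset.card_sdiff_of_subset`, `MeasureTheory.integral_finsetSum`.

WHAT IS PROVED ([folklore]; `Q_A(ω) := Σ_{x∈A}ω_x²`):
* §1 arithmetic: `card_pi_le_pow` (`#(S.pi fine) ≤ m^{#S}`);
* §2 the per-choice term: `choice_pairwiseDisjoint` (chosen fine cells of distinct big cells are disjoint), **`prod_choice_exp_eq`**
  (`∏_{p∈S}e^{½κ₁Q_{cell p}}e^{½κ₂Q_{f p}} = e^{½κ₁Q_{⋃cells} + ½κ₂Q_{⋃f}}`), `integrable_twoRate`, **`integral_choice_le`** (`≤ A₁^{v#S}A₂^{v₀#S}`);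
* §3 pointwise expansion: `norm_prod_le_prod_add`, **`prod_indicator_le_sum_choices`** (`∏_{p∈S}F_p ≤ (Me^{−½κ₂r²})^{#S}Σ_{f}∏ h_{p,f p}`);
* §4 THE END **`norm_cellActivity_le_fineCell`** (displayed); §5 toy.

HONEST (what this is NOT).  The activity letter only — the polymer-gas ∕ KP layers above it ((287), (348)–(377)) consume exactly such a letter and are
not re-run; the local letter `γ₂` for sparse unions is a HYPOTHESIS (for finite-range ∕ decaying shells: `(3^d+1)·v₀·sup|Γ_j|` by (378)'s
`local_opNorm_of_rowSum` — the successor's shell bookkeeping); the shift that produces the pointwise bound from the fine-cell two letters (Minkowski per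
fine cell, as (376)) is the successor's short file; (α4) contraction untouched; scalar skeleton ((A3), NC-NE7b-α UNRULED); nothing of Bałaban's
asserted.  BY-NAME EFFECT ON THE WALL: NONE.  NE7b NOT PRINTED ∕ NOT PROVED; spine PROVED 0∕9; rung (B)+1 — the programme's measures remain
FINITE-torus statements; NOT the mass gap, NOT Clay.  HONEST DEPENDENCY: continuum YM on T⁴ ⇐ BetaPertH ∧ nine spine estimates (0∕9 proved);
BetaPertH ⇐ (D1) ∧ (D4) ∧ CAP+tail; G-an2-4 gates asym, D1 and NE2∕3∕4.
-/

set_option autoImplicit false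

noncomputable section

namespace Summit.QuantumFields.BalabanUV.T4Continuum.NE7b.SupFineCellActivityBound

open MeasureTheory ProbabilityTheory Matrix Real Finset
open scoped BigOperators
open Literature.Probability.LatticeModels (cellActivity)
open SupFineCellRegulator (indicator_exists_le_sum integral_twoRate_le integrable_exp_half_sq_on_local exp_add_le_half_add)
open SupRegulatedActivityBound (one_le_regulatorCost card_biUnion_cell_le)

variable {ι : Type} [Fintype ι] [DecidableEq ι] {V : Type*} [DecidableEq V]

/-! ## §1. Arithmetic -/

omit [Fintype ι] [DecidableEq ι] in
/-- `#(S.pi fine) ≤ m^{#S}` when `#(fine p) ≤ m`. [folklore] -/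
theorem card_pi_le_pow {W : Type*} [DecidableEq W] (S : Finset V) (fine : V → Finset W) {m : ℕ} (hm : ∀ p, (fine p).card ≤ m) :
    (S.pi fun p => fine p).card ≤ m ^ S.card := by
  rw [Finset.card_pi]
  exact Finset.prod_le_pow_card S (fun p => (fine p).card) m fun p _ => hm p

/-! ## §2. The per-choice term: one fine cell per big cell -/

omit [Fintype ι] [DecidableEq ι] [DecidableEq V] in
/-- **Chosen fine cells of distinct big cells are pairwise disjoint** (fine cells lie in their big cell; big cells disjoint). [folklore] -/
theorem choice_pairwiseDisjoint (cell : V → Finset ι) (hdisj : ∀ p q, p ≠ q → Disjoint (cell p) (cell q)) (fine : V → Finset (Finset ι))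
    (hfine : ∀ p, ∀ c ∈ fine p, c ⊆ cell p) (S : Finset V) (f : ∀ p ∈ S, Finset ι) (hf : ∀ p (hp : p ∈ S), f p hp ∈ fine p) :
    (S.attach : Set S).PairwiseDisjoint fun p => f p.1 p.2 := by
  intro p _ q _ hpq
  have hpq' : p.1 ≠ q.1 := fun h => hpq (Subtype.ext h)
  exact (hdisj p.1 q.1 hpq').mono (hfine p.1 _ (hf p.1 p.2)) (hfine q.1 _ (hf q.1 q.2))

omit [Fintype ι] [DecidableEq V] in
/-- **THE PER-CHOICE PRODUCT IS ONE TWO-RATE REGULATOR**: for a choice `f` of one fine cell per big cell of `S`,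
`∏_{p∈S.attach} e^{½κ₁Q_{cell p}}·e^{½κ₂Q_{f p}} = e^{½κ₁Q_{S.biUnion cell} + ½κ₂Q_{⋃_p f p}}`. [folklore] -/
theorem prod_choice_exp_eq (cell : V → Finset ι) (hdisj : ∀ p q, p ≠ q → Disjoint (cell p) (cell q)) (fine : V → Finset (Finset ι))
    (hfine : ∀ p, ∀ c ∈ fine p, c ⊆ cell p) (S : Finset V) (f : ∀ p ∈ S, Finset ι) (hf : ∀ p (hp : p ∈ S), f p hp ∈ fine p)
    (κ₁ κ₂ : ℝ) (ω : EuclideanSpace ℝ ι) :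
    ∏ p ∈ S.attach, (exp (κ₁ * (∑ x ∈ cell p.1, ω x ^ 2) / 2) * exp (κ₂ * (∑ x ∈ f p.1 p.2, ω x ^ 2) / 2)) =
      exp (κ₁ * (∑ x ∈ S.biUnion cell, ω x ^ 2) / 2 + κ₂ * (∑ x ∈ S.attach.biUnion (fun p => f p.1 p.2), ω x ^ 2) / 2) := by
  have hpdS : (S : Set V).PairwiseDisjoint cell := fun p _ q _ hpq => hdisj p q hpq
  have hpdF := choice_pairwiseDisjoint cell hdisj fine hfine S f hf
  rw [prod_mul_distrib]
  have h1 : ∏ p ∈ S.attach, exp (κ₁ * (∑ x ∈ cell p.1, ω x ^ 2) / 2) = exp (κ₁ * (∑ x ∈ S.biUnion cell, ω x ^ 2) / 2) := by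
    rw [prod_attach S (fun p => exp (κ₁ * (∑ x ∈ cell p, ω x ^ 2) / 2)), ← Real.exp_sum, sum_biUnion hpdS, mul_sum, sum_div]
  have h2 : ∏ p ∈ S.attach, exp (κ₂ * (∑ x ∈ f p.1 p.2, ω x ^ 2) / 2) =
      exp (κ₂ * (∑ x ∈ S.attach.biUnion (fun p => f p.1 p.2), ω x ^ 2) / 2) := by
    rw [← Real.exp_sum, sum_biUnion hpdF, mul_sum, sum_div]
  rw [h1, h2, ← Real.exp_add]

/-- **Integrability of a two-rate regulator** (AM–GM domination by the two one-rate regulators; small rate global, large rate local). [folklore] -/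
theorem integrable_twoRate {Γ : Matrix ι ι ℝ} {γop γU κ₁ κ₂ θ : ℝ} (hΓ : Γ.PosSemidef)
    (hΓop : (γop • (1 : Matrix ι ι ℝ) - Γ).PosSemidef) (P U : Finset ι)
    (hU : (γU • (1 : Matrix U U ℝ) - Γ.submatrix (fun e : U => (e : ι)) (fun e : U => (e : ι))).PosSemidef)
    (hκ₁ : 0 ≤ κ₁) (hκ₂ : 0 ≤ κ₂) (hθ1 : θ < 1) (h1 : 2 * κ₁ * γop ≤ θ) (h2 : 2 * κ₂ * γU ≤ θ) :
    Integrable (fun ω : EuclideanSpace ℝ ι =>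
      exp (κ₁ * (∑ x ∈ P, ω x ^ 2) / 2 + κ₂ * (∑ x ∈ U, ω x ^ 2) / 2)) (multivariateGaussian 0 Γ) := by
  have h2κ₁ : 0 ≤ 2 * κ₁ := by positivity
  have h2κ₂ : 0 ≤ 2 * κ₂ := by positivity
  have hintP := SupGaussianRegulator.integrable_exp_half_sq_on hΓ hΓop h2κ₁ hθ1 h1 P
  have hintU := integrable_exp_half_sq_on_local hΓ U hU h2κ₂ hθ1 h2
  refine Integrable.mono' ((hintP.add hintU).div_const 2) (by fun_prop) (ae_of_all _ fun ω => ?_)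
  rw [Real.norm_of_nonneg (exp_pos _).le]
  have h := exp_add_le_half_add (κ₁ * (∑ x ∈ P, ω x ^ 2) / 2) (κ₂ * (∑ x ∈ U, ω x ^ 2) / 2)
  have e1 : 2 * (κ₁ * (∑ x ∈ P, ω x ^ 2) / 2) = 2 * κ₁ * (∑ x ∈ P, ω x ^ 2) / 2 := by ring
  have e2 : 2 * (κ₂ * (∑ x ∈ U, ω x ^ 2) / 2) = 2 * κ₂ * (∑ x ∈ U, ω x ^ 2) / 2 := by ring
  rw [e1, e2] at h
  exact h

/-- **THE COST OF ONE CHOICE**: `Γ ⪰ 0`, `Γ ⪯ γ_op·1`, diagonal `≤ γ` (`γ ≥ 0`); big cells of `≤ v` sites, fine cells of `≤ v₀` sites; the local letter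
`γ₂·1 − Γ|_{⋃_p f p} ⪰ 0` for the chosen sparse union; `0 ≤ κ₁, κ₂`, `0 < θ < 1`, `2κ₁γ_op ≤ θ`, `2κ₂γ₂ ≤ θ` ⟹
`∫ e^{½κ₁Q_{S.biUnion cell} + ½κ₂Q_{⋃_p f p}} dN(0,Γ) ≤ (A₁^v·A₂^{v₀})^{#S}`. [folklore] -/
theorem integral_choice_le {Γ : Matrix ι ι ℝ} {γop γ₂ γ κ₁ κ₂ θ : ℝ} (hΓ : Γ.PosSemidef)
    (hΓop : (γop • (1 : Matrix ι ι ℝ) - Γ).PosSemidef) (hdiag : ∀ x, Γ x x ≤ γ) (hγ : 0 ≤ γ) (cell : V → Finset ι)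
    {v : ℕ} (hv : ∀ p, (cell p).card ≤ v) (fine : V → Finset (Finset ι)) {v₀ : ℕ} (hv₀ : ∀ p, ∀ c ∈ fine p, c.card ≤ v₀)
    (S : Finset V) (f : ∀ p ∈ S, Finset ι) (hf : ∀ p (hp : p ∈ S), f p hp ∈ fine p)
    (hloc : (γ₂ • (1 : Matrix (S.attach.biUnion fun p => f p.1 p.2) (S.attach.biUnion fun p => f p.1 p.2) ℝ) -
      Γ.submatrix (fun e : (S.attach.biUnion fun p => f p.1 p.2) => (e : ι))
        (fun e : (S.attach.biUnion fun p => f p.1 p.2) => (e : ι))).PosSemidef)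
    (hκ₁ : 0 ≤ κ₁) (hκ₂ : 0 ≤ κ₂) (hθ0 : 0 < θ) (hθ1 : θ < 1) (h1 : 2 * κ₁ * γop ≤ θ) (h2 : 2 * κ₂ * γ₂ ≤ θ) :
    ∫ ω, exp (κ₁ * (∑ x ∈ S.biUnion cell, ω x ^ 2) / 2 + κ₂ * (∑ x ∈ S.attach.biUnion (fun p => f p.1 p.2), ω x ^ 2) / 2)
        ∂(multivariateGaussian (0 : EuclideanSpace ℝ ι) Γ) ≤
      (((1 - θ) ^ (-(2 * κ₁ * γ / (2 * θ)))) ^ v * ((1 - θ) ^ (-(2 * κ₂ * γ / (2 * θ)))) ^ v₀) ^ S.card := by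
  set A₁ : ℝ := (1 - θ) ^ (-(2 * κ₁ * γ / (2 * θ))) with hA₁
  set A₂ : ℝ := (1 - θ) ^ (-(2 * κ₂ * γ / (2 * θ))) with hA₂
  set U := S.attach.biUnion (fun p => f p.1 p.2) with hU
  have hA₁1 : 1 ≤ A₁ := one_le_regulatorCost (by positivity) hθ0 hθ1
  have hA₂1 : 1 ≤ A₂ := one_le_regulatorCost (by positivity) hθ0 hθ1
  have h := integral_twoRate_le hΓ hΓop (S.biUnion cell) U hloc hdiag hκ₁ hκ₂ hθ0 hθ1 h1 h2 (γ := γ)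
  refine h.trans ?_
  -- `#(S.biUnion cell) ≤ v#S`, `#U ≤ v₀#S`, bases `≥ 1`, then `(x+y)/2 ≤ xy`
  have hcardP : (S.biUnion cell).card ≤ v * S.card := card_biUnion_cell_le cell hv S
  have hcardU : U.card ≤ v₀ * S.card := by
    calc U.card ≤ ∑ p ∈ S.attach, (f p.1 p.2).card := card_biUnion_le
      _ ≤ S.attach.card • v₀ := sum_le_card_nsmul _ _ _ fun p _ => hv₀ p.1 _ (hf p.1 p.2)
      _ = v₀ * S.card := by rw [card_attach, smul_eq_mul, mul_comm]
  calc (A₁ ^ (S.biUnion cell).card + A₂ ^ U.card) / 2 ≤ (A₁ ^ (v * S.card) + A₂ ^ (v₀ * S.card)) / 2 := by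
        have e1 := pow_le_pow_right₀ hA₁1 hcardP
        have e2 := pow_le_pow_right₀ hA₂1 hcardU
        linarith
    _ ≤ A₁ ^ (v * S.card) * A₂ ^ (v₀ * S.card) := by
        -- `(x + y)/2 ≤ xy` for `x, y ≥ 1` (the tree's `Literature.NumberTheory.Sieve.BFI.half_add_le_mul`, inlined)
        have e1 : (1 : ℝ) ≤ A₁ ^ (v * S.card) := one_le_pow₀ hA₁1
        have e2 : (1 : ℝ) ≤ A₂ ^ (v₀ * S.card) := one_le_pow₀ hA₂1
        nlinarith
    _ = (A₁ ^ v * A₂ ^ v₀) ^ S.card := by rw [mul_pow, ← pow_mul, ← pow_mul]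

/-! ## §3. Pointwise expansion -/

omit [Fintype ι] [DecidableEq ι] [DecidableEq V] in
/-- `‖∏_{p∈K}g_p(ω)‖ ≤ ∏_{p∈K}(ε + F_p(ω))` from `‖g_p(ω)‖ ≤ ε + F_p(ω)`. [folklore] -/
theorem norm_prod_le_prod_add {g : V → EuclideanSpace ℝ ι → ℂ} {ε : ℝ} (F : V → EuclideanSpace ℝ ι → ℝ) (K : Finset V)
    (hpt : ∀ p ω, ‖g p ω‖ ≤ ε + F p ω) (ω : EuclideanSpace ℝ ι) : ‖∏ p ∈ K, g p ω‖ ≤ ∏ p ∈ K, (ε + F p ω) := by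
  rw [norm_prod]
  exact prod_le_prod (fun p _ => norm_nonneg _) fun p _ => hpt p ω

omit [Fintype ι] [DecidableEq ι] in
/-- **THE INDICATOR PRODUCT OVER `S` IS DOMINATED BY THE SUM OVER CHOICES**: with `F_p = 1{∃c∈fine p: r² < Q_c}·M·e^{½κ₁Q_{cell p}}`, `0 ≤ M`, `0 ≤ κ₂`:
`∏_{p∈S}F_p(ω) ≤ (M·e^{−½κ₂r²})^{#S}·Σ_{f∈S.pi fine}∏_{p∈S.attach}e^{½κ₁Q_{cell p}(ω)}e^{½κ₂Q_{f p}(ω)}`. [folklore] -/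
theorem prod_indicator_le_sum_choices (cell : V → Finset ι) (fine : V → Finset (Finset ι)) {M κ₁ κ₂ r : ℝ} (hM : 0 ≤ M) (hκ₂ : 0 ≤ κ₂)
    (S : Finset V) (ω : EuclideanSpace ℝ ι) :
    ∏ p ∈ S, (if ∃ c ∈ fine p, r ^ 2 < ∑ x ∈ c, ω x ^ 2 then M * exp (κ₁ * (∑ x ∈ cell p, ω x ^ 2) / 2) else 0) ≤
      (M * exp (-(κ₂ * r ^ 2 / 2))) ^ S.card *
        ∑ f ∈ S.pi (fun p => fine p), ∏ p ∈ S.attach,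
          (exp (κ₁ * (∑ x ∈ cell p.1, ω x ^ 2) / 2) * exp (κ₂ * (∑ x ∈ f p.1 p.2, ω x ^ 2) / 2)) := by
  -- per big cell: (378)'s union bound, then `M` and `e^{−½κ₂r²}` out
  have hper : ∀ p ∈ S, (if ∃ c ∈ fine p, r ^ 2 < ∑ x ∈ c, ω x ^ 2 then M * exp (κ₁ * (∑ x ∈ cell p, ω x ^ 2) / 2) else 0) ≤
      (M * exp (-(κ₂ * r ^ 2 / 2))) *
        ∑ c ∈ fine p, exp (κ₁ * (∑ x ∈ cell p, ω x ^ 2) / 2) * exp (κ₂ * (∑ x ∈ c, ω x ^ 2) / 2) := by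
    intro p _
    have h := indicator_exists_le_sum (fine p) (fun c => ∑ x ∈ c, ω x ^ 2) (G := M * exp (κ₁ * (∑ x ∈ cell p, ω x ^ 2) / 2))
      (κ₂ := κ₂) (r := r) (by positivity) hκ₂
    refine h.trans (le_of_eq ?_)
    rw [Finset.mul_sum (fine p), Finset.mul_sum (fine p)]
    exact sum_congr rfl fun c _ => by ring
  have hnonneg : ∀ p ∈ S, 0 ≤ (if ∃ c ∈ fine p, r ^ 2 < ∑ x ∈ c, ω x ^ 2 then M * exp (κ₁ * (∑ x ∈ cell p, ω x ^ 2) / 2) else 0) :=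
    fun p _ => by split_ifs <;> positivity
  calc ∏ p ∈ S, (if ∃ c ∈ fine p, r ^ 2 < ∑ x ∈ c, ω x ^ 2 then M * exp (κ₁ * (∑ x ∈ cell p, ω x ^ 2) / 2) else 0)
      ≤ ∏ p ∈ S, ((M * exp (-(κ₂ * r ^ 2 / 2))) *
          ∑ c ∈ fine p, exp (κ₁ * (∑ x ∈ cell p, ω x ^ 2) / 2) * exp (κ₂ * (∑ x ∈ c, ω x ^ 2) / 2)) := prod_le_prod hnonneg hper
    _ = (M * exp (-(κ₂ * r ^ 2 / 2))) ^ S.card *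
          ∏ p ∈ S, ∑ c ∈ fine p, exp (κ₁ * (∑ x ∈ cell p, ω x ^ 2) / 2) * exp (κ₂ * (∑ x ∈ c, ω x ^ 2) / 2) := by
        rw [prod_mul_distrib, prod_const]
    _ = _ := by rw [Finset.prod_sum S (fun p => fine p)
          (fun p c => exp (κ₁ * (∑ x ∈ cell p, ω x ^ 2) / 2) * exp (κ₂ * (∑ x ∈ c, ω x ^ 2) / 2))]

/-! ## §4. THE END: the activity letter with fine-cell large-field bookkeeping -/

/-- **THE ACTIVITY LETTER WITH FINE-CELL LARGE-FIELD BOOKKEEPING.**  `Γ ⪰ 0`, `Γ ⪯ γ_op·1`, diagonal `≤ γ` (`γ ≥ 0`); disjoint big cells of `≤ v`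
sites; fine cells inside their big cell, of `≤ v₀` sites, `≤ m` per big cell; factors with the fine-cell two-letter pointwise bound (`0 ≤ ε`, `0 ≤ M`);
rates `0 ≤ κ₁, κ₂`, `0 < θ < 1` with the GLOBAL margin `2κ₁γ_op ≤ θ` and the LOCAL margin `2κ₂γ₂ ≤ θ` for every sparse union of chosen fine cells ⟹
for every finite `K`: `‖∫∏_{p∈K}g_p dN(0,Γ)‖ ≤ (ε + m·M·e^{−½κ₂r²}·A₁^v·A₂^{v₀})^{#K}`. [folklore] -/
theorem norm_cellActivity_le_fineCell {Γ : Matrix ι ι ℝ} {γop γ₂ γ : ℝ} (hΓ : Γ.PosSemidef)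
    (hΓop : (γop • (1 : Matrix ι ι ℝ) - Γ).PosSemidef) (hdiag : ∀ x, Γ x x ≤ γ) (hγ : 0 ≤ γ) (cell : V → Finset ι)
    (hdisj : ∀ p q, p ≠ q → Disjoint (cell p) (cell q)) {v : ℕ} (hv : ∀ p, (cell p).card ≤ v) (fine : V → Finset (Finset ι))
    (hfine : ∀ p, ∀ c ∈ fine p, c ⊆ cell p) {v₀ : ℕ} (hv₀ : ∀ p, ∀ c ∈ fine p, c.card ≤ v₀) {m : ℕ} (hm : ∀ p, (fine p).card ≤ m)
    (hloc : ∀ (S : Finset V) (f : ∀ p ∈ S, Finset ι), (∀ p (hp : p ∈ S), f p hp ∈ fine p) →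
      (γ₂ • (1 : Matrix (S.attach.biUnion fun p => f p.1 p.2) (S.attach.biUnion fun p => f p.1 p.2) ℝ) -
        Γ.submatrix (fun e : (S.attach.biUnion fun p => f p.1 p.2) => (e : ι))
          (fun e : (S.attach.biUnion fun p => f p.1 p.2) => (e : ι))).PosSemidef)
    {g : V → EuclideanSpace ℝ ι → ℂ} {ε M κ₁ κ₂ θ r : ℝ} (hε : 0 ≤ ε) (hM : 0 ≤ M) (hκ₁ : 0 ≤ κ₁) (hκ₂ : 0 ≤ κ₂) (hθ0 : 0 < θ)
    (hθ1 : θ < 1) (h1 : 2 * κ₁ * γop ≤ θ) (h2 : 2 * κ₂ * γ₂ ≤ θ)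
    (hpt : ∀ p ω, ‖g p ω‖ ≤ ε + (if ∃ c ∈ fine p, r ^ 2 < ∑ x ∈ c, ω x ^ 2 then M * exp (κ₁ * (∑ x ∈ cell p, ω x ^ 2) / 2) else 0))
    (K : Finset V) :
    ‖cellActivity (multivariateGaussian (0 : EuclideanSpace ℝ ι) Γ) g K‖ ≤
      (ε + m * M * exp (-(κ₂ * r ^ 2 / 2)) *
        (((1 - θ) ^ (-(2 * κ₁ * γ / (2 * θ)))) ^ v * ((1 - θ) ^ (-(2 * κ₂ * γ / (2 * θ)))) ^ v₀)) ^ K.card := by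
  set μ := multivariateGaussian (0 : EuclideanSpace ℝ ι) Γ with hμ
  set AA : ℝ := ((1 - θ) ^ (-(2 * κ₁ * γ / (2 * θ)))) ^ v * ((1 - θ) ^ (-(2 * κ₂ * γ / (2 * θ)))) ^ v₀ with hAA
  set a : ℝ := M * exp (-(κ₂ * r ^ 2 / 2)) with ha
  -- the per-choice integrand and its integrability ∕ cost
  set h : ∀ (S : Finset V), (∀ p ∈ S, Finset ι) → EuclideanSpace ℝ ι → ℝ := fun S f ω =>
    ∏ p ∈ S.attach, (exp (κ₁ * (∑ x ∈ cell p.1, ω x ^ 2) / 2) * exp (κ₂ * (∑ x ∈ f p.1 p.2, ω x ^ 2) / 2)) with hh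
  have hAA0 : 0 ≤ AA := by positivity
  have ha0 : 0 ≤ a := by positivity
  have hint : ∀ S ∈ K.powerset, ∀ f ∈ S.pi (fun p => fine p), Integrable (h S f) μ := by
    intro S _ f hf
    have hf' : ∀ p (hp : p ∈ S), f p hp ∈ fine p := fun p hp => Finset.mem_pi.1 hf p hp
    have heq : h S f = fun ω => exp (κ₁ * (∑ x ∈ S.biUnion cell, ω x ^ 2) / 2 +
        κ₂ * (∑ x ∈ S.attach.biUnion (fun p => f p.1 p.2), ω x ^ 2) / 2) :=
      funext fun ω => prod_choice_exp_eq cell hdisj fine hfine S f hf' κ₁ κ₂ ω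
    rw [heq]
    exact integrable_twoRate hΓ hΓop _ _ (hloc S f hf') hκ₁ hκ₂ hθ1 h1 h2
  have hcost : ∀ S ∈ K.powerset, ∀ f ∈ S.pi (fun p => fine p), ∫ ω, h S f ω ∂μ ≤ AA ^ S.card := by
    intro S _ f hf
    have hf' : ∀ p (hp : p ∈ S), f p hp ∈ fine p := fun p hp => Finset.mem_pi.1 hf p hp
    have heq : ∀ ω, h S f ω = exp (κ₁ * (∑ x ∈ S.biUnion cell, ω x ^ 2) / 2 +
        κ₂ * (∑ x ∈ S.attach.biUnion (fun p => f p.1 p.2), ω x ^ 2) / 2) :=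
      fun ω => prod_choice_exp_eq cell hdisj fine hfine S f hf' κ₁ κ₂ ω
    simp_rw [heq]
    exact integral_choice_le hΓ hΓop hdiag hγ cell hv fine hv₀ S f hf' (hloc S f hf') hκ₁ hκ₂ hθ0 hθ1 h1 h2
  -- the dominating function: `Σ_S ε^{#(K∖S)}·a^{#S}·Σ_f h S f`
  have hdom_int : Integrable (fun ω => ∑ S ∈ K.powerset, ε ^ (K \ S).card * (a ^ S.card *
      ∑ f ∈ S.pi (fun p => fine p), h S f ω)) μ := by
    refine integrable_finsetSum _ fun S hS => ?_
    exact ((integrable_finsetSum _ fun f hf => hint S hS f hf).const_mul _).const_mul _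
  unfold cellActivity
  calc ‖∫ ω, ∏ p ∈ K, g p ω ∂μ‖ ≤ ∫ ω, ‖∏ p ∈ K, g p ω‖ ∂μ := norm_integral_le_integral_norm _
    _ ≤ ∫ ω, ∑ S ∈ K.powerset, ε ^ (K \ S).card * (a ^ S.card * ∑ f ∈ S.pi (fun p => fine p), h S f ω) ∂μ := by
        refine integral_mono_of_nonneg (ae_of_all _ fun _ => norm_nonneg _) hdom_int (ae_of_all _ fun ω => ?_)
        -- pointwise: `‖∏g‖ ≤ ∏(ε + F) = Σ_S (∏_S F)·ε^{#(K∖S)} ≤ Σ_S ε^{#(K∖S)}·a^{#S}·Σ_f h`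
        refine (norm_prod_le_prod_add (fun p ω => if ∃ c ∈ fine p, r ^ 2 < ∑ x ∈ c, ω x ^ 2 then
          M * exp (κ₁ * (∑ x ∈ cell p, ω x ^ 2) / 2) else 0) K hpt ω).trans ?_
        have hexpand := Finset.prod_add (fun p => if ∃ c ∈ fine p, r ^ 2 < ∑ x ∈ c, ω x ^ 2 then
          M * exp (κ₁ * (∑ x ∈ cell p, ω x ^ 2) / 2) else 0) (fun _ => ε) K
        simp only [prod_const] at hexpand
        rw [show (∏ p ∈ K, (ε + (if ∃ c ∈ fine p, r ^ 2 < ∑ x ∈ c, ω x ^ 2 then M * exp (κ₁ * (∑ x ∈ cell p, ω x ^ 2) / 2) else 0))) =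
          ∏ p ∈ K, ((if ∃ c ∈ fine p, r ^ 2 < ∑ x ∈ c, ω x ^ 2 then M * exp (κ₁ * (∑ x ∈ cell p, ω x ^ 2) / 2) else 0) + ε)
          from prod_congr rfl fun _ _ => add_comm _ _, hexpand]
        refine sum_le_sum fun S hS => ?_
        rw [mul_comm]
        refine mul_le_mul_of_nonneg_left ?_ (pow_nonneg hε _)
        exact prod_indicator_le_sum_choices cell fine hM hκ₂ S ω
    _ = ∑ S ∈ K.powerset, ε ^ (K \ S).card * (a ^ S.card * ∑ f ∈ S.pi (fun p => fine p), ∫ ω, h S f ω ∂μ) := by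
        rw [integral_finsetSum _ fun S hS => ((integrable_finsetSum _ fun f hf => hint S hS f hf).const_mul _).const_mul _]
        refine sum_congr rfl fun S hS => ?_
        rw [integral_const_mul, integral_const_mul, integral_finsetSum _ fun f hf => hint S hS f hf]
    _ ≤ ∑ S ∈ K.powerset, ε ^ (K \ S).card * (a ^ S.card * ((m : ℝ) ^ S.card * AA ^ S.card)) := by
        refine sum_le_sum fun S hS => mul_le_mul_of_nonneg_left (mul_le_mul_of_nonneg_left ?_ (pow_nonneg ha0 _)) (pow_nonneg hε _)
        calc ∑ f ∈ S.pi (fun p => fine p), ∫ ω, h S f ω ∂μ ≤ ∑ _f ∈ S.pi (fun p => fine p), AA ^ S.card :=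
              sum_le_sum fun f hf => hcost S hS f hf
          _ = (S.pi (fun p => fine p)).card * AA ^ S.card := by rw [sum_const, nsmul_eq_mul]
          _ ≤ (m : ℝ) ^ S.card * AA ^ S.card := by
              refine mul_le_mul_of_nonneg_right ?_ (pow_nonneg hAA0 _)
              exact_mod_cast card_pi_le_pow S fine hm
    _ = ∑ S ∈ K.powerset, (m * M * exp (-(κ₂ * r ^ 2 / 2)) * AA) ^ S.card * ε ^ (K.card - S.card) := by
        refine sum_congr rfl fun S hS => ?_
        rw [card_sdiff_of_subset (mem_powerset.1 hS), ha, mul_pow, mul_pow, mul_pow, mul_pow]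
        ring
    _ = (ε + m * M * exp (-(κ₂ * r ^ 2 / 2)) * AA) ^ K.card := by
        rw [Finset.sum_pow_mul_eq_add_pow, add_comm]

/-! ## §5. Toy -/

omit [Fintype ι] [DecidableEq ι] in
/-- Toy (§1): with NO fine cells anywhere (`fine = ∅`) there is exactly one (empty) choice on `∅` and none elsewhere: `#(S.pi ∅) ≤ 0^{#S}`. -/
example (S : Finset V) : (S.pi fun _ => (∅ : Finset (Finset ι))).card ≤ 0 ^ S.card :=
  card_pi_le_pow S (fun _ => ∅) fun _ => le_rfl

end Summit.QuantumFields.BalabanUV.T4Continuum.NE7b.SupFineCellActivityBound
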